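import Literature.Barriers.Parity.SiegelZeroDichotomyChowla
import HarnessLib

/-!
# Step (iii) of Tao–Teräväinen at `k = 0`, algebraic part: the Siegel model as a Dirichlet
# convolution, `λ_Siegel = (λ ∗ μχ)_(≤R) ∗ χ`, and the error `λ♭_Siegel = λ_Siegel - λ♯_Siegel`

Topic `Literature/Barriers/Parity`, sub-namespace `TaoTeravainen`; a file of the proof DAG of
`Literature.Barriers.Parity.TaoTeravainen2021_chowla` (see `SiegelZeroDichotomyChowla.lean`), towards
the named fact `TaoTeravainen2021_prop63_k0` (Proposition 6.3 at `k = 0`). Everything here is PROVED.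

§6 of the source opens: "From (4.1), (2.2), (2.1) and Möbius inversion we have
`λ_Siegel = λ_(≤R) ∗ (μχ)_(≤R) ∗ χ_(≤R) ∗ χ_(>R) = (λ ∗ μχ)_(≤R) ∗ χ`. We now split
`λ_Siegel = λ♯_Siegel + λ♭_Siegel` where `λ♯_Siegel := (λ ∗ μχ)_(≤R) ψ_{≤D} ∗ χ` and
`λ♭_Siegel := (λ ∗ μχ)_(≤R) ψ_{>D} ∗ χ`." This file proves exactly this for the tree's objects
`liouvilleSiegel` (defined in `SiegelZeroDichotomyChowla.lean` directly as the completely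
multiplicative function of (4.1)) and `liouvilleSiegelSharp` (defined there as the divisor sum (6.2)):

* `chiAF χ`, `smoothAF N`, `lamMuChiAF χ`, `siegelCoeffAF χ N` — the real arithmetic functions `χ`
  (through `realChar`), `1_{ℕ_(≤R)}` (`N = ⌊R⌋₊ + 1`, Mathlib's `Nat.smoothNumbers N`), `λ ∗ μχ` and
  `g := (λ ∗ μχ)_(≤R)`; all multiplicative for quadratic `χ`, with their values at prime powers
  (`lamMuChiAF_apply_prime_pow`: `(λ ∗ μχ)(pⁱ) = (-1)ⁱ (1 + χ(p))` for `i ≥ 1`);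
* `liouvilleSiegelAF_eq` — **`λ_Siegel = (λ ∗ μχ)_(≤R) ∗ χ`** as arithmetic functions (both sides
  are multiplicative; at prime powers the partial sums `S_k = ∑_{i ≤ k} g(pⁱ) χ(p)^{k-i}` obey
  `S_{k+1} = χ(p) S_k + g(p^{k+1})`), and its pointwise form `liouvilleSiegel_eq_sum`;
* `liouvilleSiegelFlat` — `λ♭_Siegel(n) := ∑_{de = n, d ∈ ℕ_(≤R)} (λ ∗ μχ)(d) (1 - ψ(log_D d)) χ(e)`
  ((6.3) with `ψ_{>D} = 1 - ψ_{≤D}`, (2.13)), and `liouvilleSiegel_sub_liouvilleSiegelSharp`: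
  **`λ_Siegel - λ♯_Siegel = λ♭_Siegel`** (the split (6.1)).
  [cite: TaoTeravainen2021, §6 (first display), (6.1)–(6.3), with (4.1), (2.13)]

Design: `χ` enters through `realChar χ n = Re χ(n)`; for quadratic `χ` (`MulChar.IsQuadratic`, part of
`IsSiegelZero`) `realChar` is completely multiplicative with values in `{0, ±1}`, which is all that is
used. No hypothesis on `R` or `D` is needed for the algebra. NOT here: any estimate (Lemma 6.1 and
Proposition 6.3 are in the sequel files `SiegelZeroDichotomyChowlaStep3*.lean`).
-/

noncomputable section

open Finset ArithmeticFunction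

namespace Literature.Barriers.Parity.TaoTeravainen

variable {q : ℕ} (χ : DirichletCharacter ℂ q)

/-! ### `realChar` for a quadratic character -/

/-- For a quadratic character, `Re χ(n) ∈ {0, 1, -1}`. [folklore] -/
theorem realChar_trichotomy (hχ : χ.IsQuadratic) (n : ℕ) :
    realChar χ n = 0 ∨ realChar χ n = 1 ∨ realChar χ n = -1 := by
  unfold realChar
  rcases hχ (n : ZMod q) with h | h | h <;> simp [h]

/-- For a quadratic character, `χ(n)` is the real number `Re χ(n)`. [folklore] -/
theorem realChar_coe (hχ : χ.IsQuadratic) (n : ℕ) : ((realChar χ n : ℝ) : ℂ) = χ (n : ZMod q) := by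
  unfold realChar
  rcases hχ (n : ZMod q) with h | h | h <;> simp [h]

/-- `Re χ(1) = 1`. [folklore] -/
@[simp] theorem realChar_one : realChar χ 1 = 1 := by
  simp [realChar]

/-- For a quadratic character, `n ↦ Re χ(n)` is completely multiplicative. [folklore] -/
theorem realChar_mul (hχ : χ.IsQuadratic) (m n : ℕ) :
    realChar χ (m * n) = realChar χ m * realChar χ n := by
  have h := realChar_coe χ hχ (m * n)
  rw [Nat.cast_mul, map_mul, ← realChar_coe χ hχ m, ← realChar_coe χ hχ n] at h
  exact_mod_cast h

/-- For a quadratic character, `Re χ(nᵏ) = (Re χ(n))ᵏ`. [folklore] -/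
theorem realChar_pow (hχ : χ.IsQuadratic) (n k : ℕ) : realChar χ (n ^ k) = realChar χ n ^ k := by
  induction k with
  | zero => simp
  | succ k ih => rw [pow_succ, realChar_mul χ hχ, ih, pow_succ]

/-! ### The arithmetic functions `χ`, `1_{ℕ_(≤R)}`, `λ ∗ μχ`, `(λ ∗ μχ)_(≤R)` -/

/-- `χ` as a real arithmetic function: `n ↦ Re χ(n)` for `n ≥ 1` (and `0 ↦ 0`). [folklore] -/
def chiAF : ArithmeticFunction ℝ :=
  ⟨fun n => if n = 0 then 0 else realChar χ n, if_pos rfl⟩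

/-- `chiAF χ n = Re χ(n)` for `n ≠ 0`. [folklore] -/
theorem chiAF_apply {n : ℕ} (hn : n ≠ 0) : chiAF χ n = realChar χ n := by
  simp [chiAF, hn]

/-- `chiAF χ` is multiplicative for quadratic `χ`. [folklore] -/
theorem isMultiplicative_chiAF (hχ : χ.IsQuadratic) : (chiAF χ).IsMultiplicative := by
  refine ⟨by simp [chiAF], fun {m n} _ => ?_⟩
  rcases Nat.eq_zero_or_pos m with rfl | hm
  · simp [chiAF]
  rcases Nat.eq_zero_or_pos n with rfl | hn
  · simp [chiAF]
  rw [chiAF_apply χ (Nat.mul_ne_zero hm.ne' hn.ne'), chiAF_apply χ hm.ne', chiAF_apply χ hn.ne',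
    realChar_mul χ hχ]

/-- The indicator `1_{ℕ_(≤R)}` of the `R`-smooth numbers as a real arithmetic function
(`ℕ_(≤R) = Nat.smoothNumbers N` with `N = ⌊R⌋₊ + 1`: all prime factors `< N`).
[cite: TaoTeravainen2021, §2.3] -/
def smoothAF (N : ℕ) : ArithmeticFunction ℝ :=
  ⟨fun n => if n ∈ N.smoothNumbers then 1 else 0, by simp [Nat.mem_smoothNumbers]⟩

/-- `smoothAF N n = 1` on `N`-smooth numbers and `0` elsewhere. [folklore] -/
theorem smoothAF_apply (N n : ℕ) : smoothAF N n = if n ∈ N.smoothNumbers then 1 else 0 := rfl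

/-- `1_{ℕ_(≤R)}` is multiplicative ("the multiplicative semigroups of `z`-smooth … numbers").
[cite: TaoTeravainen2021, §2.3] -/
theorem isMultiplicative_smoothAF (N : ℕ) : (smoothAF N).IsMultiplicative := by
  refine ⟨by simp [smoothAF_apply, Nat.mem_smoothNumbers], fun {m n} _ => ?_⟩
  simp only [smoothAF_apply]
  by_cases hm : m ∈ N.smoothNumbers
  · by_cases hn : n ∈ N.smoothNumbers
    · rw [if_pos (Nat.mul_mem_smoothNumbers hm hn), if_pos hm, if_pos hn, one_mul]
    · rw [if_neg hn, if_pos hm, mul_zero, if_neg]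
      exact fun h => hn (Nat.mem_smoothNumbers_of_dvd h (Dvd.intro_left m rfl))
  · rw [if_neg hm, zero_mul, if_neg]
    exact fun h => hm (Nat.mem_smoothNumbers_of_dvd h (Dvd.intro n rfl))

/-- A prime power `pⁱ` is `N`-smooth iff `i = 0` or `p < N`. [folklore] -/
theorem prime_pow_mem_smoothNumbers_iff {p : ℕ} (hp : p.Prime) (N i : ℕ) :
    p ^ i ∈ N.smoothNumbers ↔ i = 0 ∨ p < N := by
  rw [Nat.mem_smoothNumbers]
  constructor
  · rintro ⟨-, h⟩
    rcases Nat.eq_zero_or_pos i with rfl | hi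
    · exact Or.inl rfl
    · exact Or.inr (h p (by
        rw [Nat.mem_primeFactorsList (pow_ne_zero _ hp.ne_zero)]
        exact ⟨hp, dvd_pow_self p hi.ne'⟩))
  · intro h
    refine ⟨pow_ne_zero _ hp.ne_zero, fun r hr => ?_⟩
    rw [Nat.mem_primeFactorsList (pow_ne_zero _ hp.ne_zero)] at hr
    rcases h with rfl | h
    · exact absurd (Nat.le_of_dvd one_pos (by simpa using hr.2)) hr.1.one_lt.not_ge
    · rwa [(Nat.prime_dvd_prime_iff_eq hr.1 hp).mp (hr.1.dvd_of_dvd_pow hr.2)]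

/-- `p < ⌊R⌋₊ + 1 ↔ p ≤ R` for `p ≥ 1` (the threshold of `ℕ_(≤R)`). [folklore] -/
theorem lt_floor_add_one_iff {p : ℕ} (hp : 1 ≤ p) (R : ℝ) : p < ⌊R⌋₊ + 1 ↔ (p : ℝ) ≤ R := by
  rw [Nat.lt_succ_iff]
  rcases le_or_gt 0 R with hR | hR
  · exact Nat.le_floor_iff hR
  · rw [Nat.floor_of_nonpos hR.le]
    constructor
    · intro h; omega
    · intro h
      have : (1 : ℝ) ≤ p := by exact_mod_cast hp
      linarith

/-- The Dirichlet convolution `λ ∗ μχ` as a real arithmetic function. [cite: TaoTeravainen2021, §6 (first display)] -/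
def lamMuChiAF : ArithmeticFunction ℝ :=
  (liouville : ArithmeticFunction ℝ) * ((moebius : ArithmeticFunction ℝ).pmul (chiAF χ))

/-- `lamMuChiAF χ` is the function `lamMuChi χ` of `SiegelZeroDichotomyChowla.lean`. [folklore] -/
theorem lamMuChiAF_apply (d : ℕ) : lamMuChiAF χ d = lamMuChi χ d := by
  rw [lamMuChiAF, mul_apply, lamMuChi]
  refine sum_congr rfl fun p hp => ?_
  obtain ⟨h1, h2⟩ := Nat.mem_divisorsAntidiagonal.mp hp
  have hp2 : p.2 ≠ 0 := right_ne_zero_of_mul (h1 ▸ h2)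
  rw [pmul_apply, intCoe_apply, intCoe_apply, chiAF_apply χ hp2, mul_assoc]

/-- `λ ∗ μχ` is multiplicative (for quadratic `χ`). [folklore] -/
theorem isMultiplicative_lamMuChiAF (hχ : χ.IsQuadratic) : (lamMuChiAF χ).IsMultiplicative :=
  isMultiplicative_liouville.intCast.mul (isMultiplicative_moebius.intCast.pmul
    (isMultiplicative_chiAF χ hχ))

/-- `λ(pᵐ) = (-1)ᵐ` (as a real number). [folklore] -/
theorem liouville_prime_pow_cast {p : ℕ} (hp : p.Prime) (m : ℕ) :
    ((liouville (p ^ m) : ℤ) : ℝ) = (-1) ^ m := by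
  rw [liouville_apply (pow_ne_zero _ hp.ne_zero), cardFactors_apply_prime_pow hp]
  push_cast
  rfl

/-- **`(λ ∗ μχ)(pⁱ) = (-1)ⁱ (1 + χ(p))` for `i ≥ 1`** (only `μ(1), μ(p)` contribute). This is the
computation behind "`λ ∗ μχ` agrees with `λ ∗ μλ = 1_{{1}}` on `ℕ_(p)`" when `χ(p) = -1`, and behind
`P_j(z) = 1 - 2z + 2z² - …` when `χ(p) = +1`. [cite: TaoTeravainen2021, §6 (proof of Lemma 6.1)] -/
theorem lamMuChiAF_apply_prime_pow {p : ℕ} (hp : p.Prime) {i : ℕ} (hi : i ≠ 0) :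
    lamMuChiAF χ (p ^ i) = (-1) ^ i * (1 + realChar χ p) := by
  obtain ⟨k, rfl⟩ : ∃ k, i = k + 1 := ⟨i - 1, by omega⟩
  rw [lamMuChiAF, mul_apply, Nat.sum_divisorsAntidiagonal' fun a b =>
    (liouville : ArithmeticFunction ℝ) a * ((moebius : ArithmeticFunction ℝ).pmul (chiAF χ)) b,
    Nat.divisors_prime_pow hp, Finset.sum_map]
  simp only [Function.Embedding.coeFn_mk, pmul_apply, intCoe_apply]
  rw [Finset.sum_range_succ', Finset.sum_range_succ']
  -- the terms with `b = p^{j+2}` vanish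
  rw [Finset.sum_eq_zero fun j _ => by
    rw [moebius_apply_prime_pow hp (by omega : j + 1 + 1 ≠ 0), if_neg (by omega)]; simp]
  rw [pow_zero, Nat.div_one, zero_add, pow_one,
    show p ^ (k + 1) / p = p ^ k by rw [pow_succ, Nat.mul_div_cancel _ hp.pos],
    liouville_prime_pow_cast hp, liouville_prime_pow_cast hp,
    moebius_apply_prime hp, moebius_apply_one, chiAF_apply χ hp.ne_zero, chiAF_apply χ one_ne_zero,
    realChar_one]
  push_cast
  ring

/-- The coefficient sequence **`g := (λ ∗ μχ)_(≤R)`** of the Siegel model, `N = ⌊R⌋₊ + 1`.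
[cite: TaoTeravainen2021, §6 (first display)] -/
def siegelCoeffAF (N : ℕ) : ArithmeticFunction ℝ :=
  (lamMuChiAF χ).pmul (smoothAF N)

/-- `g(d) = 1_{ℕ_(≤R)}(d) (λ ∗ μχ)(d)`. [cite: TaoTeravainen2021, §6 (first display)] -/
theorem siegelCoeffAF_apply (N d : ℕ) :
    siegelCoeffAF χ N d = if d ∈ N.smoothNumbers then lamMuChi χ d else 0 := by
  rw [siegelCoeffAF, pmul_apply, lamMuChiAF_apply, smoothAF_apply]
  split_ifs <;> simp

/-- `g` is multiplicative (for quadratic `χ`). [folklore] -/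
theorem isMultiplicative_siegelCoeffAF (hχ : χ.IsQuadratic) (N : ℕ) :
    (siegelCoeffAF χ N).IsMultiplicative :=
  (isMultiplicative_lamMuChiAF χ hχ).pmul (isMultiplicative_smoothAF N)

/-- `g(pⁱ) = 1_{p < N} (-1)ⁱ (1 + χ(p))` for `i ≥ 1`. [cite: TaoTeravainen2021, §6 (proof of Lemma 6.1)] -/
theorem siegelCoeffAF_apply_prime_pow (N : ℕ) {p : ℕ} (hp : p.Prime) {i : ℕ} (hi : i ≠ 0) :
    siegelCoeffAF χ N (p ^ i) = if p < N then (-1) ^ i * (1 + realChar χ p) else 0 := by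
  rw [siegelCoeffAF, pmul_apply, smoothAF_apply, lamMuChiAF_apply_prime_pow χ hp hi]
  by_cases h : p < N <;> simp [prime_pow_mem_smoothNumbers_iff hp, hi, h]

/-! ### `λ_Siegel = (λ ∗ μχ)_(≤R) ∗ χ` -/

/-- `λ_Siegel` as an arithmetic function (`0 ↦ 0`). [cite: TaoTeravainen2021, §4 (4.1)] -/
def liouvilleSiegelAF (R : ℝ) : ArithmeticFunction ℝ :=
  ⟨fun n => if n = 0 then 0 else liouvilleSiegel χ R n, if_pos rfl⟩

/-- `liouvilleSiegelAF χ R n = λ_Siegel(n)` for `n ≠ 0`. [folklore] -/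
theorem liouvilleSiegelAF_apply (R : ℝ) {n : ℕ} (hn : n ≠ 0) :
    liouvilleSiegelAF χ R n = liouvilleSiegel χ R n := by
  simp [liouvilleSiegelAF, hn]

/-- `λ_Siegel` is multiplicative. [cite: TaoTeravainen2021, §4 (4.1)] -/
theorem isMultiplicative_liouvilleSiegelAF (R : ℝ) : (liouvilleSiegelAF χ R).IsMultiplicative := by
  refine ⟨by simp [liouvilleSiegelAF, liouvilleSiegel], fun {m n} _ => ?_⟩
  rcases eq_or_ne m 0 with rfl | hm
  · simp [liouvilleSiegelAF]
  rcases eq_or_ne n 0 with rfl | hn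
  · simp [liouvilleSiegelAF]
  rw [liouvilleSiegelAF_apply χ R (mul_ne_zero hm hn), liouvilleSiegelAF_apply χ R hm,
    liouvilleSiegelAF_apply χ R hn, liouvilleSiegel_mul χ R hm hn]

/-- `λ_Siegel(pᵏ) = (-1)ᵏ` if `p ≤ R`, `= χ(p)ᵏ` if `p > R`. [cite: TaoTeravainen2021, §4 (4.1)] -/
theorem liouvilleSiegel_prime_pow (R : ℝ) {p : ℕ} (hp : p.Prime) (k : ℕ) :
    liouvilleSiegel χ R (p ^ k) = (if (p : ℝ) ≤ R then -1 else realChar χ p) ^ k := by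
  induction k with
  | zero => simp [liouvilleSiegel]
  | succ k ih =>
    rw [pow_succ, liouvilleSiegel_mul χ R (pow_ne_zero _ hp.ne_zero) hp.ne_zero, ih,
      liouvilleSiegel_apply_prime χ R hp, pow_succ]

/-- The convolution `(g ∗ χ)(pᵏ)` as a sum over `0 ≤ i ≤ k`. [folklore] -/
theorem siegelCoeffAF_mul_chiAF_prime_pow (hχ : χ.IsQuadratic) (N : ℕ) {p : ℕ} (hp : p.Prime)
    (k : ℕ) :
    (siegelCoeffAF χ N * chiAF χ) (p ^ k) =
      ∑ i ∈ range (k + 1), siegelCoeffAF χ N (p ^ i) * realChar χ p ^ (k - i) := by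
  rw [mul_apply, Nat.sum_divisorsAntidiagonal fun a b => siegelCoeffAF χ N a * chiAF χ b,
    Nat.divisors_prime_pow hp, Finset.sum_map]
  refine sum_congr rfl fun i hi => ?_
  simp only [Function.Embedding.coeFn_mk]
  rw [Nat.pow_div (Nat.lt_succ_iff.mp (mem_range.mp hi)) hp.pos,
    chiAF_apply χ (pow_ne_zero _ hp.ne_zero), realChar_pow χ hχ]

/-- **`λ_Siegel = (λ ∗ μχ)_(≤R) ∗ χ`** ("From (4.1), (2.2), (2.1) and Möbius inversion"), as an
identity of real arithmetic functions, `N = ⌊R⌋₊ + 1`. Both sides are multiplicative; at `pᵏ`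
the right side `S_k = ∑_{i ≤ k} g(pⁱ) χ(p)^{k-i}` satisfies `S_{k+1} = χ(p) S_k + g(p^{k+1})` with
`g(p^{k+1}) = 1_{p ≤ R} (-1)^{k+1} (1 + χ(p))`, whence `S_k = χ(p)ᵏ` (`p > R`) and `S_k = (-1)ᵏ`
(`p ≤ R`) by induction. [cite: TaoTeravainen2021, §6 (first display)] -/
theorem liouvilleSiegelAF_eq (hχ : χ.IsQuadratic) (R : ℝ) :
    liouvilleSiegelAF χ R = siegelCoeffAF χ (⌊R⌋₊ + 1) * chiAF χ := by
  rw [(isMultiplicative_liouvilleSiegelAF χ R).eq_iff_eq_on_prime_powers _ _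
    ((isMultiplicative_siegelCoeffAF χ hχ _).mul (isMultiplicative_chiAF χ hχ))]
  intro p k hp
  rw [liouvilleSiegelAF_apply χ R (pow_ne_zero _ hp.ne_zero), liouvilleSiegel_prime_pow χ R hp,
    siegelCoeffAF_mul_chiAF_prime_pow χ hχ _ hp]
  have hpR : (p < ⌊R⌋₊ + 1) ↔ (p : ℝ) ≤ R := lt_floor_add_one_iff hp.one_lt.le R
  induction k with
  | zero => simp [(isMultiplicative_siegelCoeffAF χ hχ (⌊R⌋₊ + 1)).map_one]
  | succ k ih =>
    rw [Finset.sum_range_succ, Nat.sub_self, pow_zero, mul_one,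
      siegelCoeffAF_apply_prime_pow χ _ hp (Nat.succ_ne_zero k)]
    have hS : ∑ i ∈ range (k + 1), siegelCoeffAF χ (⌊R⌋₊ + 1) (p ^ i) * realChar χ p ^ (k + 1 - i) =
        realChar χ p *
          ∑ i ∈ range (k + 1), siegelCoeffAF χ (⌊R⌋₊ + 1) (p ^ i) * realChar χ p ^ (k - i) := by
      rw [Finset.mul_sum]
      refine sum_congr rfl fun i hi => ?_
      rw [show k + 1 - i = (k - i) + 1 by have := mem_range.mp hi; omega, pow_succ]
      ring
    rw [hS, ← ih]
    by_cases h : (p : ℝ) ≤ R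
    · rw [if_pos h, if_pos (hpR.mpr h), pow_succ]
      ring
    · rw [if_neg h, if_neg (fun h' => h (hpR.mp h')), pow_succ]
      ring

/-- Pointwise form: for `n ≥ 1`,
`λ_Siegel(n) = ∑_{de = n} 1_{ℕ_(≤R)}(d) (λ ∗ μχ)(d) χ(e)`. [cite: TaoTeravainen2021, §6 (first display)] -/
theorem liouvilleSiegel_eq_sum (hχ : χ.IsQuadratic) (R : ℝ) {n : ℕ} (hn : n ≠ 0) :
    liouvilleSiegel χ R n = ∑ p ∈ n.divisorsAntidiagonal,
      (if p.1 ∈ Nat.smoothNumbers (⌊R⌋₊ + 1) then lamMuChi χ p.1 else 0) * realChar χ p.2 := by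
  rw [← liouvilleSiegelAF_apply χ R hn, liouvilleSiegelAF_eq χ hχ R, mul_apply]
  refine sum_congr rfl fun p hp => ?_
  obtain ⟨h1, h2⟩ := Nat.mem_divisorsAntidiagonal.mp hp
  rw [siegelCoeffAF_apply, chiAF_apply χ (right_ne_zero_of_mul (h1 ▸ h2))]

/-! ### `λ♭_Siegel` and the split (6.1) -/

/-- **The error term** `λ♭_Siegel := (λ ∗ μχ)_(≤R) ψ_{>D} ∗ χ` ((6.3)), i.e.
`λ♭_Siegel(n) = ∑_{de = n, d ∈ ℕ_(≤R)} (λ ∗ μχ)(d) (1 - ψ(log_D d)) χ(e)` with `ψ_{>D} = 1 - ψ_{≤D}`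
((2.13)). [cite: TaoTeravainen2021, §6 (6.3) and §2.5 (2.13)] -/
def liouvilleSiegelFlat (ψ : ℝ → ℝ) (R D : ℝ) (n : ℕ) : ℝ :=
  ∑ p ∈ n.divisorsAntidiagonal,
    (if p.1 ∈ Nat.smoothNumbers (⌊R⌋₊ + 1) then
        lamMuChi χ p.1 * (1 - ψ (Real.log p.1 / Real.log D)) else 0) * realChar χ p.2

/-- **The split `λ_Siegel = λ♯_Siegel + λ♭_Siegel`** ((6.1)): for `n ≥ 1` and quadratic `χ`,
`λ_Siegel(n) - λ♯_Siegel(n) = λ♭_Siegel(n)`. [cite: TaoTeravainen2021, §6 (6.1)–(6.3)] -/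
theorem liouvilleSiegel_sub_liouvilleSiegelSharp (hχ : χ.IsQuadratic) (ψ : ℝ → ℝ) (R D : ℝ) {n : ℕ}
    (hn : n ≠ 0) :
    liouvilleSiegel χ R n - liouvilleSiegelSharp χ ψ R D n = liouvilleSiegelFlat χ ψ R D n := by
  rw [liouvilleSiegel_eq_sum χ hχ R hn, liouvilleSiegelSharp, liouvilleSiegelFlat, ← sum_sub_distrib]
  refine sum_congr rfl fun p _ => ?_
  split_ifs <;> ring

end Literature.Barriers.Parity.TaoTeravainen
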